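import Summits.BirchSwinnertonDyer.BirchSwinnertonDyer.Theorems.ErratumRoadFiveRamNoErratumDataKolyvaginTam
import Summits.BirchSwinnertonDyer.BirchSwinnertonDyer.Theorems.ErratumRoadFiveRest3NoWitnessRung5595f1
import Summits.BirchSwinnertonDyer.BirchSwinnertonDyer.Theorems.ErratumRoadFiveRest3TorsionRung5190r1
import Summits.BirchSwinnertonDyer.BirchSwinnertonDyer.Theorems.ErratumRoadFiveRamNoErratumDataRung5015b1
import Summits.BirchSwinnertonDyer.BirchSwinnertonDyer.Theorems.Rank2ObservatoryTamagawaCert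
import HarnessLib

/-!
# Route `ErratumRoadFive` (rung K2, `p ≥ 5`), crux `RamNoErratumDataAtFive` (item 19624) and its children (T) 19702 ∕ (NW)
# 19703: the plan-only rungs `(5595f1, 5)` ((NW) ∩ off-Locus: `stub_rung_rest4_5595f1` = `stub_rung_nw_5595f1`) and
# `(5190r1, 5)` ((T): `stub_rung_t_5190r1`) ON THE TAMAGAWA-SLACK ROAD — route p2's open input `P2OpenInputOnTreeAt E 5`
# from PUBLISHED named facts + ONE kernel Tate row certificate + ONE attested Heegner-index certificate; NO `p`-adic
# regulator, NO preprint, NO lever facts (cell `bsd-stepL`, seat `bsd-stepL-rest-p2` g2; `--supports … --as helper`)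

HONEST FRAMING: THEOREMS ONLY (no definition, no named fact, no `sorry`); CONDITIONAL on every displayed binder; ONE
curve per theorem; nothing is booked; no census word moves (T7). The attested binders are EXISTENTIAL data (a field, a
parametrisation datum, a Heegner datum, the Heegner point and two inequalities about it) — a finite computation, three
runs of the seat's census engine (kit j261047 ∕ j261562 ∕ j261919: engine A = the Heegner point `y_K = Σ_Q φ(τ_Q)`
computed analytically at the `h(d)` level-`N` Heegner points and recognised on the period lattice as `n·y_K ≡ m·g`,
`g` = Cremona's generator; engine B = Gross–Zagier `m² = √|d|·L′(E,1)·L(E^d,1)/(4·area(Λ_E)·ĥ(g))`, independent code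
path, ratio `1.000…` at both pairs; `#E(K)_tors` by `elltors` over `K`), for `(5595f1, −59)` also seat g0's kit j255090
(`y_K = 5·(−5,4)` to `10⁻⁷²`). They are NOT kernel-checked.

## Why these rungs (the slack road next to the regulator road)

Seat g0 landed both rungs on the cyclotomic LEVER road (`rung_5595f1_of_regCert`, p453656; `rung_5190r1_of_regCert`,
p453225): published facts + the lever's published facts (Skinner 2016 Thm. A, Stein–Wuthrich Thm. 6.1 ∕ §4.2, Disegni
Thm. 1) + ONE attested `p`-adic regulator `hReg` (PARI `ellpadicregulator`, the only engine at a multiplicative `p`). On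
REST⁗ (`t := ord_p ∏ c_ℓ ≥ 1`) the classical Kolyvagin index certificate `p ∤ [E(K):ℤy_K]` is impossible ((T):
`p ∣ c_p ∣ [E(K):ℤy_K]`; `5595f1`: `ord₅ [E(K):ℤy_K] = 1` at every field, g0 kit j255090) — but nw1's per-pair tool
`openInputOnTreeAt_of_slackIndexAt_of_thm331Mult` (p462332) needs only `ord_p [E(K):ℤP] ≤ t`: STEP L
`2·ord_p[E(K):ℤP] ≤ ord_p #Ш(E/K) + 2t` is then free, and rigidity + tightness give the open input at EVERY datum of the
pair from Gross–Zagier, Kolyvagin, Skinner 2016 Thm. C, GZK, modularity and JSW17 Thm. 3.3.1-mult ONLY. This file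
reads the census rows of the two plan-only rungs as such certificates (packaged by the owner's
`openInputOnTreeAt_of_exists_slackDatum_of_thm331Mult`, p473288): the rungs now stand on refereed print + one
Heegner-index computation, with fewer riders than the lever road (no Schneider-type input).

## What this file proves

* §1 kernel Tate ROW certificates (`TamLocal.rowCheck`, `decide +kernel`): `∏_ℓ c_ℓ(5595f1) = 5` (`3`: split `I₅`,
  `5`: non-split `I₁`, `373`: split `I₁`) and `∏_ℓ c_ℓ(5190r1) = 480` (`2, 3, 5, 173`: split `I₁₂, I₈, I₅, I₁`), hence
  `ord₅ ∏ c_ℓ = 1` at both pairs.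
* §2 `rung_5595f1_d59_of_slackCert` — the registered signature of `stub_rung_rest4_5595f1` ∕ `stub_rung_nw_5595f1` as
  conclusion, from `hGZ hKo hSk hGZK hmod h331` + the attested datum over `ℚ(√−59)` (`h = 3`, `β = 259`, `y_K = 5·g`,
  `E(K)_tors = 1`, `ord₅ [E(K):ℤy_K] = 1 ≤ 1`); `rung_5595f1_d59_of_items_of_slackCert` by the route's names.
* §3 `rung_5190r1_d431_of_slackCert` — the registered signature of `stub_rung_t_5190r1` as conclusion, same published
  binders + the attested datum over `ℚ(√−431)` (`h = 21`, `β = 407`, `y_K = 240·g` up to `K`-torsion, `#E(K)_tors = 2`,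
  `ord₅ [E(K):ℤy_K] = 1 ≤ 1`) — a (T) pair (`E(ℚ₅)[5] ≠ 0`, `5 ∣ c₅ = 5`): the torsion branch's first certificate on a
  road WITHOUT the `p`-adic regulator; `rung_5190r1_d431_of_items_of_slackCert` by the route's names.

References: [cite: Gross1991, (1.1), Thm. 1.3, (2.2)] [cite: GrossZagier1986, Thm. I.(6.3), V.§2 (p. 312)]
[cite: JetchevSkinnerWan2017, Thm. 3.3.1, §7.4.1 (pp. 30–31)] [cite: Skinner2016PacificMC, Thm. C (§1)]
[cite: Kolyvagin1990, Thm. A] [cite: SilvermanATAEC1994, IV.9.4] [cite: Cremona1997, Table 1 (curves 5190r1, 5595f1), §2.10]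
[cite: AgasheRibetStein2006, Appendix (Cremona): optimal curve = number 1, Manin constant 1].
-/

set_option autoImplicit false
-- the Theorems namespace of this sub repeats the summit name by design (D-0017 nested layout)
set_option linter.dupNamespace false

noncomputable section

open scoped Classical

open WeierstrassCurve IsDedekindDomain NumberField
  Literature.NumberTheory.EllipticCurves Literature.NumberTheory.EllipticCurves.ModularForms
  Literature.NumberTheory.EllipticCurves.Rank1Residual
  Literature.NumberTheory.EllipticCurves.Rank1Residual.Typed
  Literature.NumberTheory.EllipticCurves.JetchevSkinnerWan2017
  Summit.BirchSwinnertonDyer.Rank1Residual Summit.BirchSwinnertonDyer.Rank1Residual.X11b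
  Summit.BirchSwinnertonDyer.BirchSwinnertonDyer.Rank2Observatory.Tam
  Summit.BirchSwinnertonDyer.BirchSwinnertonDyer.Theses.ErratumRoadFive

namespace Summit.BirchSwinnertonDyer.BirchSwinnertonDyer.Theorems

/-! ## §1 Kernel Tate row certificates: `∏_ℓ c_ℓ(5595f1) = 5`, `∏_ℓ c_ℓ(5190r1) = 480` -/

/-- **Tate ROW certificate of `5595f1 = [1, 0, 0, −71, −234]`** (`Δ = 3⁵·5·373`): `3` split multiplicative (node root `0`;
`c₃ = v₃(Δ) = 5`), `5` non-split by exhaustion (`c₅ = 1`, `v₅(Δ) = 1` odd), `373` split (node root `105`; `c₃₇₃ = 1`),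
checked by `decide +kernel`. [cite: SilvermanATAEC1994, IV.9.4] [cite: Cremona1997, Table 1 (curve 5595f1)] -/
theorem tamRow_5595f1 :
    TamLocal.rowCheck [⟨3, 1, 1, 0, 0, 0, 0, 5, 0, 0, 5⟩, ⟨5, 2, 2, 0, 0, 0, 0, 1, 0, 0, 1⟩, ⟨373, 19, 1, 105, 0, 0, 0, 1, 0, 0, 1⟩]
      ⟨1, 0, 0, -71, -234⟩ = true := by
  decide +kernel

/-- **`∏_ℓ c_ℓ(5595f1) = 5`** in the kernel (every row is multiplicative, so the certificate is exact).
[cite: SilvermanATAEC1994, IV.9.4] [cite: Cremona1997, Table 1 (curve 5595f1)] -/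
theorem tamagawaProduct_5595f1 [((⟨1, 0, 0, -71, -234⟩ : WeierstrassCurve ℤ).baseChange ℚ).IsGloballyMinimal] :
    ((⟨1, 0, 0, -71, -234⟩ : WeierstrassCurve ℤ).baseChange ℚ).tamagawaProduct = 5 := by
  have h := TamLocal.tamagawaProduct_eq tamRow_5595f1 ‹_› (by decide +kernel)
  rw [h]
  decide +kernel

/-- **`ord₅ ∏_ℓ c_ℓ(5595f1) = 1`** (the Tamagawa exponent that absorbs the Heegner index; the carrier is `c₃ = 5`).
[cite: Gross1991, (2.2)] [cite: Cremona1997, Table 1 (curve 5595f1)] -/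
theorem padicValNat_tamagawaProduct_5595f1 [((⟨1, 0, 0, -71, -234⟩ : WeierstrassCurve ℤ).baseChange ℚ).IsGloballyMinimal] :
    padicValNat 5 ((⟨1, 0, 0, -71, -234⟩ : WeierstrassCurve ℤ).baseChange ℚ).tamagawaProduct = 1 := by
  rw [tamagawaProduct_5595f1]
  simp

/-- **Tate ROW certificate of `5190r1 = [1, 0, 0, −9535, 307097]`** (`Δ = 2¹²·3⁸·5⁵·173`): `2, 3, 5, 173` all SPLIT
multiplicative (node roots `0, 0, 1, 53`; `c = v(Δ) = 12, 8, 5, 1`), checked by `decide +kernel`.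
[cite: SilvermanATAEC1994, IV.9.4] [cite: Cremona1997, Table 1 (curve 5190r1)] -/
theorem tamRow_5190r1 :
    TamLocal.rowCheck [⟨2, 1, 1, 0, 0, 0, 0, 12, 0, 0, 12⟩, ⟨3, 1, 1, 0, 0, 0, 0, 8, 0, 0, 8⟩, ⟨5, 2, 1, 1, 0, 0, 0, 5, 0, 0, 5⟩,
        ⟨173, 13, 1, 53, 0, 0, 0, 1, 0, 0, 1⟩]
      ⟨1, 0, 0, -9535, 307097⟩ = true := by
  decide +kernel

/-- **`∏_ℓ c_ℓ(5190r1) = 480 = 12·8·5·1`** in the kernel (every row multiplicative, exact certificate).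
[cite: SilvermanATAEC1994, IV.9.4] [cite: Cremona1997, Table 1 (curve 5190r1)] -/
theorem tamagawaProduct_5190r1 [((⟨1, 0, 0, -9535, 307097⟩ : WeierstrassCurve ℤ).baseChange ℚ).IsGloballyMinimal] :
    ((⟨1, 0, 0, -9535, 307097⟩ : WeierstrassCurve ℤ).baseChange ℚ).tamagawaProduct = 480 := by
  have h := TamLocal.tamagawaProduct_eq tamRow_5190r1 ‹_› (by decide +kernel)
  rw [h]
  decide +kernel

/-- **`ord₅ ∏_ℓ c_ℓ(5190r1) = 1`** (`480 = 2⁵·3·5`; the carrier is `c₅ = 5` at the split exceptional prime itself — the (T)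
mechanism `E(ℚ₅)[5] ≠ 0 ⇒ 5 ∣ c₅`). [cite: Gross1991, (2.2)] [cite: Cremona1997, Table 1 (curve 5190r1)] -/
theorem padicValNat_tamagawaProduct_5190r1
    [((⟨1, 0, 0, -9535, 307097⟩ : WeierstrassCurve ℤ).baseChange ℚ).IsGloballyMinimal] :
    padicValNat 5 ((⟨1, 0, 0, -9535, 307097⟩ : WeierstrassCurve ℤ).baseChange ℚ).tamagawaProduct = 1 := by
  haveI : Fact (Nat.Prime 5) := ⟨by norm_num⟩
  rw [tamagawaProduct_5190r1, show (480 : ℕ) = 5 * 96 by norm_num, padicValNat.mul (by norm_num) (by norm_num),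
    padicValNat.self (by norm_num), padicValNat.eq_zero_of_not_dvd (by norm_num)]

/-! ## §2 The rung `(5595f1, 5)` on the slack road: `K = ℚ(√−59)`, `y_K = 5·g`, `ord₅ [E(K):ℤy_K] = 1 = ord₅ ∏ c_ℓ` -/

/-- **PLAN-ONLY RUNG `(5595f1, 5)` — `stub_rung_rest4_5595f1` (crux 19624) ∕ `stub_rung_nw_5595f1` (19703), registered
signature as conclusion — ON THE TAMAGAWA-SLACK ROAD.** Published binders: Gross–Zagier `hGZ`, Kolyvagin `hKo`,
Skinner 2016 Thm. C `hSk`, GZK `hGZK`, modularity `hmod`, the Jetchev–Skinner–Wan control fact `h331`. Attested binders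
(kit j261919 rows `5595f1`; also j261047 ∕ j261562 and g0's j255090 — NOT kernel-checked): an imaginary quadratic `K` with
`d_K = −59` (Heegner for `N = 5595 = 3·5·373`: `3, 5, 373` split), a parametrisation datum `Dt` of level `N_E` with `5 ∤ c`
(the optimal `Γ₀(5595)`-parametrisation, Manin constant `1`, read with `c = 1`), a Heegner datum `H` (`β = 259`, `h(−59) = 3`
classes), an embedding `ι`, and the Heegner point `P = Σ_Q φ(τ_Q) ∈ E(K)`: engine A finds `P = 5·g` on the period lattice
(`g = (−5, 4)` Cremona's generator; lattice distance `2·10⁻¹⁴`, next candidate `3·10⁻³`), engine B (Gross–Zagier special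
values, `L(E^{−59},1) = 1.93853…`) gives `m² = 25.000…`; `E(K)_tors = 1`; so `P` is non-torsion and
`ord₅ [E(K):ℤP] = 1 ≤ 1`. Proof: the crux's binders give X11b; the (ram) witness `373` is kernel-decided (g0's
`ram_five_5595f1`); §1 turns `≤ 1` into `≤ ord₅ ∏ c_ℓ`; then the owner's `openInputOnTreeAt_of_exists_slackDatum_of_thm331Mult`
(`w_K = 2`, `L(E^{d_K},1) ≠ 0` from non-torsion, a minimal twist model, nw1's slack tool). CONDITIONAL on every binder; ONE
curve; NO `p`-adic regulator, NO lever fact, NO preprint; nothing booked. [cite: Gross1991, (1.1), Thm. 1.3, (2.2)]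
[cite: JetchevSkinnerWan2017, Thm. 3.3.1, §7.4.1 (pp. 30–31)] [cite: Skinner2016PacificMC, Thm. C (§1)]
[cite: Kolyvagin1990, Thm. A] [cite: Cremona1997, Table 1 (curve 5595f1), §2.10] -/
theorem rung_5595f1_d59_of_slackCert
    [((⟨1, 0, 0, -71, -234⟩ : WeierstrassCurve ℤ).baseChange ℚ).IsElliptic]
    [((⟨1, 0, 0, -71, -234⟩ : WeierstrassCurve ℤ).baseChange ℚ).IsGloballyMinimal]
    [NeZero (((⟨1, 0, 0, -71, -234⟩ : WeierstrassCurve ℤ).baseChange ℚ).conductorNorm ℤ)]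
    -- published named facts
    (hGZ : ∀ (N : ℕ) [NeZero N] (W : WeierstrassCurve ℚ) (K : Type) [Field K] [NumberField K],
      gross_zagier N W K)
    (hKo : ∀ (N : ℕ) [NeZero N] (W : WeierstrassCurve ℚ) (K : Type) [Field K] [NumberField K],
      kolyvagin N W K)
    (hSk : Skinner2016.thmC_padicValRat_bsd_rank_zero)
    (hGZK : rank_eq_analyticRank_of_analyticRank_le_one) (hmod : hasEntireLFunction_rat)
    (h331 : thm331_anticyclotomicControl_mult)
    -- the attested Tamagawa-slack Heegner datum (kit j261919; g0 j255090): K = ℚ(√−59), β = 259, P = y_K = 5·g, E(K)_tors = 1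
    (K : Type) [Field K] [NumberField K] (hK : IsImaginaryQuadratic K) (hdK : NumberField.discr K = -59)
    (hH : SatisfiesHeegnerHypothesis (((⟨1, 0, 0, -71, -234⟩ : WeierstrassCurve ℤ).baseChange ℚ).conductorNorm ℤ) K)
    (Dt : ModularParametrizationData ((⟨1, 0, 0, -71, -234⟩ : WeierstrassCurve ℤ).baseChange ℚ)
      (((⟨1, 0, 0, -71, -234⟩ : WeierstrassCurve ℤ).baseChange ℚ).conductorNorm ℤ))
    (H : HeegnerDatum (((⟨1, 0, 0, -71, -234⟩ : WeierstrassCurve ℤ).baseChange ℚ).conductorNorm ℤ) (NumberField.discr K))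
    (ι : K →+* ℂ) (P : ((((⟨1, 0, 0, -71, -234⟩ : WeierstrassCurve ℤ).baseChange ℚ)).baseChange K).toAffine.Point)
    (hP : WeierstrassCurve.Affine.Point.map ι.toRatAlgHom P = heegnerPointComplex Dt H)
    (hc : ¬ (5 : ℤ) ∣ Dt.c) (hnt : ¬ IsOfFinAddOrder P)
    (hidx : padicValNat 5 (AddSubgroup.zmultiples P).index ≤ 1) :
    Summit.BirchSwinnertonDyer.Rank1Residual.X11b.P2OpenInputOnTreeAt
      ((⟨1, 0, 0, -71, -234⟩ : WeierstrassCurve ℤ).baseChange ℚ) 5 := by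
  refine p2OpenInputOnTreeAt_of_imp_surj _ 5 fun hX _ _ ↦ ?_
  have hodd : Odd (NumberField.discr K) := by rw [hdK]; decide
  have hlt : NumberField.discr K < -4 := by rw [hdK]; norm_num
  have hidx' : padicValNat 5 (AddSubgroup.zmultiples P).index ≤
      padicValNat 5 ((⟨1, 0, 0, -71, -234⟩ : WeierstrassCurve ℤ).baseChange ℚ).tamagawaProduct := by
    rw [padicValNat_tamagawaProduct_5595f1]; exact hidx
  exact openInputOnTreeAt_of_exists_slackDatum_of_thm331Mult _ 5 hGZ hKo hSk hGZK hmod h331 hX ram_five_5595f1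
    ⟨K, inferInstance, inferInstance, Dt, H, ι, P, hK, hodd, hlt, hH, hP, hc, hnt, hidx'⟩

/-- **The rung `(5595f1, 5)` with the published facts bound BY THE ROUTE'S NAMES**: `PublishedInputsFive` (support item
19066: its Gross–Zagier, Kolyvagin, Skinner 2016 Thm. C, GZK, modularity conjuncts) + `JSWAnticyclotomicControlMult` (19626) +
the attested slack datum. CONDITIONAL; ONE curve; nothing booked. [cite: Gross1991, (1.1), (2.2)] [cite: JetchevSkinnerWan2017, Thm. 3.3.1] -/
theorem rung_5595f1_d59_of_items_of_slackCert
    [((⟨1, 0, 0, -71, -234⟩ : WeierstrassCurve ℤ).baseChange ℚ).IsElliptic]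
    [((⟨1, 0, 0, -71, -234⟩ : WeierstrassCurve ℤ).baseChange ℚ).IsGloballyMinimal]
    [NeZero (((⟨1, 0, 0, -71, -234⟩ : WeierstrassCurve ℤ).baseChange ℚ).conductorNorm ℤ)]
    (hF : PublishedInputsFive) (h331 : JSWAnticyclotomicControlMult)
    (K : Type) [Field K] [NumberField K] (hK : IsImaginaryQuadratic K) (hdK : NumberField.discr K = -59)
    (hH : SatisfiesHeegnerHypothesis (((⟨1, 0, 0, -71, -234⟩ : WeierstrassCurve ℤ).baseChange ℚ).conductorNorm ℤ) K)
    (Dt : ModularParametrizationData ((⟨1, 0, 0, -71, -234⟩ : WeierstrassCurve ℤ).baseChange ℚ)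
      (((⟨1, 0, 0, -71, -234⟩ : WeierstrassCurve ℤ).baseChange ℚ).conductorNorm ℤ))
    (H : HeegnerDatum (((⟨1, 0, 0, -71, -234⟩ : WeierstrassCurve ℤ).baseChange ℚ).conductorNorm ℤ) (NumberField.discr K))
    (ι : K →+* ℂ) (P : ((((⟨1, 0, 0, -71, -234⟩ : WeierstrassCurve ℤ).baseChange ℚ)).baseChange K).toAffine.Point)
    (hP : WeierstrassCurve.Affine.Point.map ι.toRatAlgHom P = heegnerPointComplex Dt H)
    (hc : ¬ (5 : ℤ) ∣ Dt.c) (hnt : ¬ IsOfFinAddOrder P)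
    (hidx : padicValNat 5 (AddSubgroup.zmultiples P).index ≤ 1) :
    Summit.BirchSwinnertonDyer.Rank1Residual.X11b.P2OpenInputOnTreeAt
      ((⟨1, 0, 0, -71, -234⟩ : WeierstrassCurve ℤ).baseChange ℚ) 5 := by
  obtain ⟨hGZ, hKo, -, hSk, -, hGZK, hmod, -, -, -, -, -, -, -, -⟩ := hF
  exact rung_5595f1_d59_of_slackCert hGZ hKo hSk hGZK hmod h331 K hK hdK hH Dt H ι P hP hc hnt hidx

/-! ## §3 The (T) rung `(5190r1, 5)` on the slack road: `K = ℚ(√−431)`, `y_K ≡ 240·g`, `ord₅ [E(K):ℤy_K] = 1 = ord₅ ∏ c_ℓ` -/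

/-- **BC5 RUNG `(5190r1, 5)` of the torsion branch (T) — `stub_rung_t_5190r1` (crux 19702), registered signature as
conclusion — ON THE TAMAGAWA-SLACK ROAD.** `5190r1`: `N = 5190 = 2·3·5·173 ≥ 5000`, SPLIT at `5` with `v₅(Δ) = c₅ = 5`
and `E(ℚ₅)[5] ≠ 0` (a (T) pair: erratum (iv) fails, the classical index certificate is impossible since `5 ∣ c₅ ∣ [E(K):ℤy_K]`,
Skinner–Zhang ♯ excluded). Published binders as in §2. Attested binders (kit j261919 row `5190r1`; also j261047 ∕ j261562 —
NOT kernel-checked): `K` with `d_K = −431` (Heegner for `5190`: `2, 3, 5, 173` split; `h(−431) = 21`), the optimal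
parametrisation datum read with `c = 1` (Manin constant `1`), a Heegner datum (`β = 407`), `ι`, and the Heegner point
`P = Σ_Q φ(τ_Q) ∈ E(K)`: engine A `P ≡ 240·g` on the period lattice (`g = (−16, 683)`; distance `2·10⁻¹⁴`, next `3·10⁻⁴`),
engine B `m² = 57600.000…` (`L(E^{−431},1) = 11.2840…`, `Ш_an(E^{−431}) = 1`), `#E(K)_tors = 2`; so `P` is non-torsion and
`ord₅ [E(K):ℤP] = ord₅ 240 + ord₅ 2 = 1 ≤ 1`. Proof as in §2 with g0's kernel-decided (ram) witness `173`
(`ram_five_5190r1`) and §1's `ord₅ ∏ c_ℓ = 1`. CONDITIONAL on every binder; ONE curve; NO `p`-adic regulator, NO lever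
fact, NO preprint; nothing booked. [cite: Gross1991, (1.1), Thm. 1.3, (2.2)] [cite: JetchevSkinnerWan2017, Thm. 3.3.1, §7.4.1]
[cite: Skinner2016PacificMC, Thm. C (§1)] [cite: Kolyvagin1990, Thm. A] [cite: Cremona1997, Table 1 (curve 5190r1), §2.10] -/
theorem rung_5190r1_d431_of_slackCert
    [((⟨1, 0, 0, -9535, 307097⟩ : WeierstrassCurve ℤ).baseChange ℚ).IsElliptic]
    [((⟨1, 0, 0, -9535, 307097⟩ : WeierstrassCurve ℤ).baseChange ℚ).IsGloballyMinimal]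
    [NeZero (((⟨1, 0, 0, -9535, 307097⟩ : WeierstrassCurve ℤ).baseChange ℚ).conductorNorm ℤ)]
    -- published named facts
    (hGZ : ∀ (N : ℕ) [NeZero N] (W : WeierstrassCurve ℚ) (K : Type) [Field K] [NumberField K],
      gross_zagier N W K)
    (hKo : ∀ (N : ℕ) [NeZero N] (W : WeierstrassCurve ℚ) (K : Type) [Field K] [NumberField K],
      kolyvagin N W K)
    (hSk : Skinner2016.thmC_padicValRat_bsd_rank_zero)
    (hGZK : rank_eq_analyticRank_of_analyticRank_le_one) (hmod : hasEntireLFunction_rat)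
    (h331 : thm331_anticyclotomicControl_mult)
    -- the attested Tamagawa-slack Heegner datum (kit j261919): K = ℚ(√−431), β = 407, P = y_K ≡ 240·g, #E(K)_tors = 2
    (K : Type) [Field K] [NumberField K] (hK : IsImaginaryQuadratic K) (hdK : NumberField.discr K = -431)
    (hH : SatisfiesHeegnerHypothesis (((⟨1, 0, 0, -9535, 307097⟩ : WeierstrassCurve ℤ).baseChange ℚ).conductorNorm ℤ) K)
    (Dt : ModularParametrizationData ((⟨1, 0, 0, -9535, 307097⟩ : WeierstrassCurve ℤ).baseChange ℚ)
      (((⟨1, 0, 0, -9535, 307097⟩ : WeierstrassCurve ℤ).baseChange ℚ).conductorNorm ℤ))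
    (H : HeegnerDatum (((⟨1, 0, 0, -9535, 307097⟩ : WeierstrassCurve ℤ).baseChange ℚ).conductorNorm ℤ)
      (NumberField.discr K))
    (ι : K →+* ℂ) (P : ((((⟨1, 0, 0, -9535, 307097⟩ : WeierstrassCurve ℤ).baseChange ℚ)).baseChange K).toAffine.Point)
    (hP : WeierstrassCurve.Affine.Point.map ι.toRatAlgHom P = heegnerPointComplex Dt H)
    (hc : ¬ (5 : ℤ) ∣ Dt.c) (hnt : ¬ IsOfFinAddOrder P)
    (hidx : padicValNat 5 (AddSubgroup.zmultiples P).index ≤ 1) :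
    Summit.BirchSwinnertonDyer.Rank1Residual.X11b.P2OpenInputOnTreeAt
      ((⟨1, 0, 0, -9535, 307097⟩ : WeierstrassCurve ℤ).baseChange ℚ) 5 := by
  refine p2OpenInputOnTreeAt_of_imp_surj _ 5 fun hX _ _ ↦ ?_
  have hodd : Odd (NumberField.discr K) := by rw [hdK]; decide
  have hlt : NumberField.discr K < -4 := by rw [hdK]; norm_num
  have hidx' : padicValNat 5 (AddSubgroup.zmultiples P).index ≤
      padicValNat 5 ((⟨1, 0, 0, -9535, 307097⟩ : WeierstrassCurve ℤ).baseChange ℚ).tamagawaProduct := by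
    rw [padicValNat_tamagawaProduct_5190r1]; exact hidx
  exact openInputOnTreeAt_of_exists_slackDatum_of_thm331Mult _ 5 hGZ hKo hSk hGZK hmod h331 hX ram_five_5190r1
    ⟨K, inferInstance, inferInstance, Dt, H, ι, P, hK, hodd, hlt, hH, hP, hc, hnt, hidx'⟩

/-- **The (T) rung `(5190r1, 5)` with the published facts bound BY THE ROUTE'S NAMES**: `PublishedInputsFive` (19066) +
`JSWAnticyclotomicControlMult` (19626) + the attested slack datum. CONDITIONAL; ONE curve; nothing booked.
[cite: Gross1991, (1.1), (2.2)] [cite: JetchevSkinnerWan2017, Thm. 3.3.1] -/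
theorem rung_5190r1_d431_of_items_of_slackCert
    [((⟨1, 0, 0, -9535, 307097⟩ : WeierstrassCurve ℤ).baseChange ℚ).IsElliptic]
    [((⟨1, 0, 0, -9535, 307097⟩ : WeierstrassCurve ℤ).baseChange ℚ).IsGloballyMinimal]
    [NeZero (((⟨1, 0, 0, -9535, 307097⟩ : WeierstrassCurve ℤ).baseChange ℚ).conductorNorm ℤ)]
    (hF : PublishedInputsFive) (h331 : JSWAnticyclotomicControlMult)
    (K : Type) [Field K] [NumberField K] (hK : IsImaginaryQuadratic K) (hdK : NumberField.discr K = -431)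
    (hH : SatisfiesHeegnerHypothesis (((⟨1, 0, 0, -9535, 307097⟩ : WeierstrassCurve ℤ).baseChange ℚ).conductorNorm ℤ) K)
    (Dt : ModularParametrizationData ((⟨1, 0, 0, -9535, 307097⟩ : WeierstrassCurve ℤ).baseChange ℚ)
      (((⟨1, 0, 0, -9535, 307097⟩ : WeierstrassCurve ℤ).baseChange ℚ).conductorNorm ℤ))
    (H : HeegnerDatum (((⟨1, 0, 0, -9535, 307097⟩ : WeierstrassCurve ℤ).baseChange ℚ).conductorNorm ℤ)
      (NumberField.discr K))
    (ι : K →+* ℂ) (P : ((((⟨1, 0, 0, -9535, 307097⟩ : WeierstrassCurve ℤ).baseChange ℚ)).baseChange K).toAffine.Point)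
    (hP : WeierstrassCurve.Affine.Point.map ι.toRatAlgHom P = heegnerPointComplex Dt H)
    (hc : ¬ (5 : ℤ) ∣ Dt.c) (hnt : ¬ IsOfFinAddOrder P)
    (hidx : padicValNat 5 (AddSubgroup.zmultiples P).index ≤ 1) :
    Summit.BirchSwinnertonDyer.Rank1Residual.X11b.P2OpenInputOnTreeAt
      ((⟨1, 0, 0, -9535, 307097⟩ : WeierstrassCurve ℤ).baseChange ℚ) 5 := by
  obtain ⟨hGZ, hKo, -, hSk, -, hGZK, hmod, -, -, -, -, -, -, -, -⟩ := hF
  exact rung_5190r1_d431_of_slackCert hGZ hKo hSk hGZK hmod h331 K hK hdK hH Dt H ι P hP hc hnt hidx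

/-! ## §4 (appended, seat rest-p2 g2) The Locus rung `(5015b1, 5)` on the slack road: `K = ℚ(√−179)`, `y_K = −2·g`,
`ord₅ [E(K):ℤy_K] = 0 = ord₅ ∏ c_ℓ` — the classical index certificate READ AS a slack certificate (drops g0's `Ш_an = 1` binder) -/

/-- **Tate ROW certificate of `5015b1 = [0, 0, 1, −248, 1503]`** (`Δ = −5²·17·59`): `5` non-split by exhaustion (`c₅ = 2`,
`v₅(Δ) = 2` even), `17` split (node root `3`; `c₁₇ = 1`), `59` split (node root `17`; `c₅₉ = 1`), checked by `decide +kernel`.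
[cite: SilvermanATAEC1994, IV.9.4] [cite: Cremona1997, Table 1 (curve 5015b1)] -/
theorem tamRow_5015b1 :
    TamLocal.rowCheck [⟨5, 2, 2, 0, 0, 0, 0, 2, 0, 0, 2⟩, ⟨17, 4, 1, 3, 0, 0, 0, 1, 0, 0, 1⟩, ⟨59, 7, 1, 17, 0, 0, 0, 1, 0, 0, 1⟩]
      ⟨0, 0, 1, -248, 1503⟩ = true := by
  decide +kernel

/-- **`∏_ℓ c_ℓ(5015b1) = 2`** in the kernel (every row multiplicative, exact certificate).
[cite: SilvermanATAEC1994, IV.9.4] [cite: Cremona1997, Table 1 (curve 5015b1)] -/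
theorem tamagawaProduct_5015b1 [((⟨0, 0, 1, -248, 1503⟩ : WeierstrassCurve ℤ).baseChange ℚ).IsGloballyMinimal] :
    ((⟨0, 0, 1, -248, 1503⟩ : WeierstrassCurve ℤ).baseChange ℚ).tamagawaProduct = 2 := by
  have h := TamLocal.tamagawaProduct_eq tamRow_5015b1 ‹_› (by decide +kernel)
  rw [h]
  decide +kernel

/-- **`ord₅ ∏_ℓ c_ℓ(5015b1) = 0`** (the pair lies on the Locus `p ∤ ∏ c_ℓ`; the slack inequality there IS the classical index
certificate `5 ∤ [E(K):ℤy_K]`). [cite: Gross1991, (2.2)] [cite: Cremona1997, Table 1 (curve 5015b1)] -/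
theorem padicValNat_tamagawaProduct_5015b1
    [((⟨0, 0, 1, -248, 1503⟩ : WeierstrassCurve ℤ).baseChange ℚ).IsGloballyMinimal] :
    padicValNat 5 ((⟨0, 0, 1, -248, 1503⟩ : WeierstrassCurve ℤ).baseChange ℚ).tamagawaProduct = 0 := by
  rw [tamagawaProduct_5015b1, padicValNat.eq_zero_of_not_dvd (by norm_num)]

/-- **PLAN-ONLY BC5 RUNG `(5015b1, 5)` — `stub_rung_rest3_5015b1` (crux 19624) ∕ `stub_rung_nw_5015b1` (19703), registered
signature as conclusion — ON THE TAMAGAWA-SLACK ROAD.** `5015b1`: `N = 5015 = 5·17·59 ≥ 5000`, non-split at `5` (`c₅ = 2`),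
`17` and `59` split with `v(Δ) = 1` ((ram) witnesses, no erratum prime), `∏ c_ℓ = 2`, so the pair is on the Locus and the
slack inequality `ord₅ [E(K):ℤP] ≤ ord₅ ∏ c_ℓ = 0` is the classical index certificate. Published binders: `hGZ hKo hSk hGZK
hmod h331`. Attested binders (seat g0's kit j255090: `y_K = Σ_Q φ(τ_Q)` to 120 digits, `y_K = −2·g` with `g = (9, 0)`
Cremona's generator, lattice distance `2·10⁻⁷²`; cross-checked at `d = −219` (`m = 2`) and `−259` (`m = 8`); `E(K)_tors = 1`;
NOT kernel-checked): `K` with `d_K = −179` (Heegner for `5015`; `h(−179) = 5`), the optimal parametrisation datum read with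
`c = 1` (Manin constant `1`), a Heegner datum (`β = 141`), `ι`, the Heegner point `P = −2·g ∈ E(K)` — non-torsion, with
`ord₅ [E(K):ℤP] = 0`. Compared with g0's `rung_5015b1_of_cert` (p449825) this form DROPS the analytic binder `Ш_an(E) = 1`:
at `t = 0` STEP L is free as soon as `5 ∤ [E(K):ℤP]`. Proof as in §2 with g0's kernel-decided (ram) witness `17`
(`ram_five_5015b1`). CONDITIONAL on every binder; ONE curve; nothing booked. [cite: Gross1991, (1.1), Thm. 1.3, (2.2)]
[cite: JetchevSkinnerWan2017, Thm. 3.3.1, §7.4.1] [cite: Skinner2016PacificMC, Thm. C (§1)] [cite: Kolyvagin1990, Thm. A]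
[cite: Cremona1997, Table 1 (curve 5015b1), §2.10] -/
theorem rung_5015b1_d179_of_slackCert
    [((⟨0, 0, 1, -248, 1503⟩ : WeierstrassCurve ℤ).baseChange ℚ).IsElliptic]
    [((⟨0, 0, 1, -248, 1503⟩ : WeierstrassCurve ℤ).baseChange ℚ).IsGloballyMinimal]
    [NeZero (((⟨0, 0, 1, -248, 1503⟩ : WeierstrassCurve ℤ).baseChange ℚ).conductorNorm ℤ)]
    -- published named facts
    (hGZ : ∀ (N : ℕ) [NeZero N] (W : WeierstrassCurve ℚ) (K : Type) [Field K] [NumberField K],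
      gross_zagier N W K)
    (hKo : ∀ (N : ℕ) [NeZero N] (W : WeierstrassCurve ℚ) (K : Type) [Field K] [NumberField K],
      kolyvagin N W K)
    (hSk : Skinner2016.thmC_padicValRat_bsd_rank_zero)
    (hGZK : rank_eq_analyticRank_of_analyticRank_le_one) (hmod : hasEntireLFunction_rat)
    (h331 : thm331_anticyclotomicControl_mult)
    -- the attested Heegner datum (g0 kit j255090): K = ℚ(√−179), β = 141, P = y_K = −2·g, E(K)_tors = 1
    (K : Type) [Field K] [NumberField K] (hK : IsImaginaryQuadratic K) (hdK : NumberField.discr K = -179)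
    (hH : SatisfiesHeegnerHypothesis (((⟨0, 0, 1, -248, 1503⟩ : WeierstrassCurve ℤ).baseChange ℚ).conductorNorm ℤ) K)
    (Dt : ModularParametrizationData ((⟨0, 0, 1, -248, 1503⟩ : WeierstrassCurve ℤ).baseChange ℚ)
      (((⟨0, 0, 1, -248, 1503⟩ : WeierstrassCurve ℤ).baseChange ℚ).conductorNorm ℤ))
    (H : HeegnerDatum (((⟨0, 0, 1, -248, 1503⟩ : WeierstrassCurve ℤ).baseChange ℚ).conductorNorm ℤ)
      (NumberField.discr K))
    (ι : K →+* ℂ) (P : ((((⟨0, 0, 1, -248, 1503⟩ : WeierstrassCurve ℤ).baseChange ℚ)).baseChange K).toAffine.Point)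
    (hP : WeierstrassCurve.Affine.Point.map ι.toRatAlgHom P = heegnerPointComplex Dt H)
    (hc : ¬ (5 : ℤ) ∣ Dt.c) (hnt : ¬ IsOfFinAddOrder P)
    (hidx : padicValNat 5 (AddSubgroup.zmultiples P).index = 0) :
    Summit.BirchSwinnertonDyer.Rank1Residual.X11b.P2OpenInputOnTreeAt
      ((⟨0, 0, 1, -248, 1503⟩ : WeierstrassCurve ℤ).baseChange ℚ) 5 := by
  refine p2OpenInputOnTreeAt_of_imp_surj _ 5 fun hX _ _ ↦ ?_
  have hodd : Odd (NumberField.discr K) := by rw [hdK]; decide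
  have hlt : NumberField.discr K < -4 := by rw [hdK]; norm_num
  have hidx' : padicValNat 5 (AddSubgroup.zmultiples P).index ≤
      padicValNat 5 ((⟨0, 0, 1, -248, 1503⟩ : WeierstrassCurve ℤ).baseChange ℚ).tamagawaProduct := by
    rw [padicValNat_tamagawaProduct_5015b1, hidx]
  exact openInputOnTreeAt_of_exists_slackDatum_of_thm331Mult _ 5 hGZ hKo hSk hGZK hmod h331 hX ram_five_5015b1
    ⟨K, inferInstance, inferInstance, Dt, H, ι, P, hK, hodd, hlt, hH, hP, hc, hnt, hidx'⟩

/-- **The rung `(5015b1, 5)` with the published facts bound BY THE ROUTE'S NAMES**: `PublishedInputsFive` (19066) +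
`JSWAnticyclotomicControlMult` (19626) + the attested Heegner datum. CONDITIONAL; ONE curve; nothing booked.
[cite: Gross1991, (1.1), (2.2)] [cite: JetchevSkinnerWan2017, Thm. 3.3.1] -/
theorem rung_5015b1_d179_of_items_of_slackCert
    [((⟨0, 0, 1, -248, 1503⟩ : WeierstrassCurve ℤ).baseChange ℚ).IsElliptic]
    [((⟨0, 0, 1, -248, 1503⟩ : WeierstrassCurve ℤ).baseChange ℚ).IsGloballyMinimal]
    [NeZero (((⟨0, 0, 1, -248, 1503⟩ : WeierstrassCurve ℤ).baseChange ℚ).conductorNorm ℤ)]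
    (hF : PublishedInputsFive) (h331 : JSWAnticyclotomicControlMult)
    (K : Type) [Field K] [NumberField K] (hK : IsImaginaryQuadratic K) (hdK : NumberField.discr K = -179)
    (hH : SatisfiesHeegnerHypothesis (((⟨0, 0, 1, -248, 1503⟩ : WeierstrassCurve ℤ).baseChange ℚ).conductorNorm ℤ) K)
    (Dt : ModularParametrizationData ((⟨0, 0, 1, -248, 1503⟩ : WeierstrassCurve ℤ).baseChange ℚ)
      (((⟨0, 0, 1, -248, 1503⟩ : WeierstrassCurve ℤ).baseChange ℚ).conductorNorm ℤ))
    (H : HeegnerDatum (((⟨0, 0, 1, -248, 1503⟩ : WeierstrassCurve ℤ).baseChange ℚ).conductorNorm ℤ)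
      (NumberField.discr K))
    (ι : K →+* ℂ) (P : ((((⟨0, 0, 1, -248, 1503⟩ : WeierstrassCurve ℤ).baseChange ℚ)).baseChange K).toAffine.Point)
    (hP : WeierstrassCurve.Affine.Point.map ι.toRatAlgHom P = heegnerPointComplex Dt H)
    (hc : ¬ (5 : ℤ) ∣ Dt.c) (hnt : ¬ IsOfFinAddOrder P)
    (hidx : padicValNat 5 (AddSubgroup.zmultiples P).index = 0) :
    Summit.BirchSwinnertonDyer.Rank1Residual.X11b.P2OpenInputOnTreeAt
      ((⟨0, 0, 1, -248, 1503⟩ : WeierstrassCurve ℤ).baseChange ℚ) 5 := by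
  obtain ⟨hGZ, hKo, -, hSk, -, hGZK, hmod, -, -, -, -, -, -, -, -⟩ := hF
  exact rung_5015b1_d179_of_slackCert hGZ hKo hSk hGZK hmod h331 K hK hdK hH Dt H ι P hP hc hnt hidx

end Summit.BirchSwinnertonDyer.BirchSwinnertonDyer.Theorems

end
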